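import Mathlib
import Summits.ValiantsHypothesis.ValiantsHypothesis.Theorems.NewtonUnitEquationsDissociatedUniformTotalsLaw
import Summits.ValiantsHypothesis.ValiantsHypothesis.Theorems.NewtonUnitEquationsDissociatedUniformTotalsLawChartTops
import Summits.ValiantsHypothesis.ValiantsHypothesis.Theorems.NewtonUnitEquationsDissociatedUniformTotalsLawSweep
import Summits.ValiantsHypothesis.ValiantsHypothesis.Theorems.NewtonUnitEquationsDissociatedUniformTotalsLawChartLevels
import Summits.ValiantsHypothesis.ValiantsHypothesis.Theorems.NewtonUnitEquationsDissociatedUniformTotalsLawChartLevelsTopSets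
import Summits.ValiantsHypothesis.ValiantsHypothesis.Theorems.NewtonUnitEquationsDissociatedUniformTotalsLawChartLevelsCount
import Summits.ValiantsHypothesis.ValiantsHypothesis.Theorems.NewtonUnitEquationsDissociatedUniformTotalsLawChartLevelsPairs
import Summits.ValiantsHypothesis.ValiantsHypothesis.Theorems.NewtonUnitEquationsDissociatedUniformTotalsLawTopKCells
import Literature.Computability.AlgebraicComplexity.NewtonPolygonTauProductBounds
import HarnessLib

/-!
# Crux `NewtonUnitEquations.DissociatedUniform` (stmt-ValiantsHypothesis-5905): the `n = 3` totals law — `k`-SHALLOW vertices are `O(k²q²)`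

Graded form of the shallow vertex theorem `…TotalsLawShallow` (k = 1: a letter which IS the top of its alphabet).  Call a hull vertex
`v` of class `s` **`k`-shallow in `c`** if at some chart weight `w = (σ, t)`, `σ = ±1`, at which `v` is the strict top of its class,
some spelling `v = a x + b y + c z` has its third letter among the top `k` of `C` (`rank σ C t (c z) < k`: fewer than `k` letters of
`C` strictly above it).  PROVED (arbitrary `a, b`; `c` injective; no general position):
* tools in `…TotalsLawTopKCells`: off the low-event times the top-`k` set has `≤ k` members and is constant on each CELL between
  consecutive event times; cells are pairwise time-ordered;
* **`sum_card_kshallowTops_le`** — along one half-chart,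
  `∑_s #{k-shallow tops of class s} ≤ k·∑_r #tops_σ(P_r) + |G|(k+1)(16|G|k + 1)`: tops at the `≤ 16|G|k` low-event times
  (`…ChartLevelsCount.card_lowEvents_le`, Clarkson–Shor) cost `≤ 1` per class and time; the other tops are charged to
  (position `z`, strict top of `P_{s-z}` at a time of a CELL between consecutive event times at which `c z` is in the cell's top-`k` set);
  each fibre is charged `≤ k` times per (cell, fibre top), and the cells are pairwise ordered (`…ChartTops.sum_card_chartTops_le`);
* **`sum_card_kshallow_le`** — both half-charts: `∑_s #{k-shallow-in-c vertices} ≤ k(V_P + 2|G|) + 2|G|(k+1)(16|G|k+1) = O(k²|G|²)`;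
* **`totalVert_le_of_all_kshallow`** — if every hull vertex of every class is `k`-shallow in `c` then `T ≤ k(V_P+2|G|) + 2|G|(k+1)(16|G|k+1)`:
  the `n = 3` law with constant `O(k²)` on the stratum "every vertex uses a letter within the top `k` of `C`" (k = 1: both extreme regimes;
  bounded k: the clustered near-regime configurations of memo `Cruxes/DissociatedUniform/NOTES-t1g11.md` §3, whose deep vertices have ranks ≤ 4).
By the letter symmetry of `…TotalsLawShallowAll` the same holds for `a` and `b`; so the law is equivalent, for every fixed `k`, to an
`O(q²)` bound on the vertices all of whose spellings have all three letters of rank `≥ k` at every exposing weight ("`k`-deep").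
Honest label: unconditional structure theorem; `TotalsLawThree` remains OPEN; nothing here bears on VP ≠ VNP.
[folklore: levels in arrangements of lines]
-/

set_option linter.dupNamespace false -- `ValiantsHypothesis.ValiantsHypothesis` (summit = problem) in every name

open scoped BigOperators
open Matrix Finset

namespace Summit.ValiantsHypothesis.ValiantsHypothesis.Theorems.NewtonUnitEquationsDissociatedUniform

namespace TotalsLaw

open Literature.Computability.AlgebraicComplexity.KPTT.PlanarMinkowski

/-! ### Counting the `k`-shallow tops -/

section Count

variable {G : Type*} [AddCommGroup G] [Fintype G]

open Classical in
/-- **One class, one half-chart.**  With `E` the set of low-event times of order `< k` of `C`, the `k`-shallow tops of class `s` split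
into those exposed at a time of `E` (at most one per time) and those exposed at a time `t ∉ E`, which are `c z +` a strict top of the
fibre `P_{s-z}` at a time `t ∉ E` with `rank_t (c z) < k`. [folklore] -/
theorem card_kshallowTops_class_le (a b c : G → (Fin 2 → ℝ)) (σ : ℝ) (k : ℕ) (s : G) (E : Finset ℝ) :
    ((Finset.univ.image fun p : G × G => a p.1 + b p.2 + c (s - p.1 - p.2)).filter fun v =>
        ∃ t : ℝ, ∃ p : G × G, a p.1 + b p.2 + c (s - p.1 - p.2) = v ∧
          IsStrictTop ![σ, t] (Finset.univ.image fun p : G × G => a p.1 + b p.2 + c (s - p.1 - p.2)) v ∧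
          rank σ (Finset.univ.image c) t (c (s - p.1 - p.2)) < k).card ≤
      E.card +
      ∑ z, ((Finset.univ.image fun x : G => a x + b (s - z - x)).filter fun q =>
          ∃ t : ℝ, t ∉ E ∧ rank σ (Finset.univ.image c) t (c z) < k ∧
            IsStrictTop ![σ, t] (Finset.univ.image fun x : G => a x + b (s - z - x)) q).card := by
  classical
  set F := Finset.univ.image fun p : G × G => a p.1 + b p.2 + c (s - p.1 - p.2) with hF
  set P : G → Finset (Fin 2 → ℝ) := fun r => Finset.univ.image fun x : G => a x + b (r - x) with hP
  set EV : Finset (Fin 2 → ℝ) := E.biUnion fun τ => F.filter fun v => IsStrictTop ![σ, τ] F v with hEV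
  set A : G → Finset (Fin 2 → ℝ) := fun z =>
    ((P (s - z)).filter fun q => ∃ t : ℝ, t ∉ E ∧ rank σ (Finset.univ.image c) t (c z) < k ∧
      IsStrictTop ![σ, t] (P (s - z)) q).image fun q => q + c z with hA
  have hsub : (F.filter fun v => ∃ t : ℝ, ∃ p : G × G, a p.1 + b p.2 + c (s - p.1 - p.2) = v ∧
      IsStrictTop ![σ, t] F v ∧ rank σ (Finset.univ.image c) t (c (s - p.1 - p.2)) < k) ⊆ EV ∪ Finset.univ.biUnion A := by
    intro v hv
    obtain ⟨hvF, t, ⟨x, y⟩, hxy, htop, hrk⟩ := Finset.mem_filter.1 hv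
    rw [Finset.mem_union]
    by_cases htE : t ∈ E
    · left
      rw [hEV, Finset.mem_biUnion]
      exact ⟨t, htE, Finset.mem_filter.2 ⟨hvF, htop⟩⟩
    · right
      set r := x + y with hr
      set z := s - x - y with hz
      have hs : r + z = s := by rw [hr, hz]; abel
      have hy : y = r - x := by rw [hr]; abel
      have hv' : v = a x + b (r - x) + c z := by rw [← hxy, ← hy]
      have hsz : s - z = r := by rw [← hs]; abel
      rw [hv'] at htop
      have hfib := isStrictTop_fibre_of_isStrictTop_class a b c _ s r z x hs htop
      rw [Finset.mem_biUnion]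
      refine ⟨z, Finset.mem_univ _, ?_⟩
      rw [hA, Finset.mem_image]
      refine ⟨a x + b (r - x), Finset.mem_filter.2 ⟨?_, t, htE, hrk, ?_⟩, hv'.symm⟩
      · rw [hsz]; exact Finset.mem_image.2 ⟨x, Finset.mem_univ _, rfl⟩
      · rw [hsz]; exact hfib
  have hEVcard : EV.card ≤ E.card := by
    rw [hEV]
    refine Finset.card_biUnion_le.trans ?_
    calc ∑ τ ∈ E, (F.filter fun v => IsStrictTop ![σ, τ] F v).card ≤ ∑ _τ ∈ E, 1 :=
          Finset.sum_le_sum fun τ _ => Finset.card_le_one.2 fun v hv v' hv' =>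
            (Finset.mem_filter.1 hv).2.unique (Finset.mem_filter.1 hv').2
      _ = E.card := by rw [Finset.sum_const, smul_eq_mul, mul_one]
  refine (Finset.card_le_card hsub).trans ((Finset.card_union_le _ _).trans (add_le_add hEVcard ?_))
  refine Finset.card_biUnion_le.trans (Finset.sum_le_sum fun z _ => ?_)
  rw [hA]
  exact Finset.card_image_le

open Classical in
/-- **`∑_s #{k-shallow tops}_σ ≤ k·∑_r #tops_σ(P_r) + |G|(k+1)(16|G|k+1)`** along one half-chart `σ ≠ 0`, for `c` injective and
`k ≥ 1`: the low-event times of `C` are `≤ 16|G|k` (Clarkson–Shor, `…ChartLevelsCount.card_lowEvents_le`); off them the time axis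
splits into `≤ 16|G|k + 1` pairwise ordered cells on each of which the top-`k` set of `C` is constant with `≤ k` members, so each
fibre receives at most `k·(#tops_σ(P_r) + #cells)` charges (`…ChartTops.sum_card_chartTops_le`). [folklore] -/
theorem sum_card_kshallowTops_le (a b c : G → (Fin 2 → ℝ)) (hc : Function.Injective c) {σ : ℝ} (hσ : σ ≠ 0)
    {k : ℕ} (hk : 1 ≤ k) :
    ∑ s, ((Finset.univ.image fun p : G × G => a p.1 + b p.2 + c (s - p.1 - p.2)).filter fun v =>
        ∃ t : ℝ, ∃ p : G × G, a p.1 + b p.2 + c (s - p.1 - p.2) = v ∧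
          IsStrictTop ![σ, t] (Finset.univ.image fun p : G × G => a p.1 + b p.2 + c (s - p.1 - p.2)) v ∧
          rank σ (Finset.univ.image c) t (c (s - p.1 - p.2)) < k).card ≤
      k * ∑ r, ((Finset.univ.image fun x : G => a x + b (r - x)).filter fun p =>
          ∃ t, IsStrictTop ![σ, t] (Finset.univ.image fun x : G => a x + b (r - x)) p).card +
      Fintype.card G * (k + 1) * (16 * Fintype.card G * k + 1) := by
  classical
  set C := (Finset.univ.image c : Finset (Fin 2 → ℝ)) with hCdef
  set P : G → Finset (Fin 2 → ℝ) := fun r => Finset.univ.image fun x : G => a x + b (r - x) with hP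
  -- the low-event times of `C`
  set E : Finset ℝ := (lowEvents σ C k).image Prod.fst with hE
  have hEall : ∀ e, IsLowEvent σ C k e → e.1 ∈ E := fun e he =>
    Finset.mem_image.2 ⟨e, (mem_lowEvents hσ).2 he, rfl⟩
  have hEne : ∀ t, t ∉ E → ∀ e : ℝ × ℝ, IsLowEvent σ C k e → e.1 ≠ t := fun t ht e he heq => ht (heq ▸ hEall e he)
  have hCcard : C.card ≤ Fintype.card G := Finset.card_image_le.trans (Finset.card_univ (α := G)).le
  have hEcard : E.card ≤ 16 * Fintype.card G * k := by
    calc E.card ≤ (lowEvents σ C k).card := Finset.card_image_le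
      _ ≤ 16 * C.card * k := card_lowEvents_le hσ C hk
      _ ≤ 16 * Fintype.card G * k := by gcongr
  -- per class
  set f : G → G → ℕ := fun z r => ((P r).filter fun q => ∃ t : ℝ, t ∉ E ∧ rank σ C t (c z) < k ∧
    IsStrictTop ![σ, t] (P r) q).card with hf
  have hclass : ∀ s, ((Finset.univ.image fun p : G × G => a p.1 + b p.2 + c (s - p.1 - p.2)).filter fun v =>
      ∃ t : ℝ, ∃ p : G × G, a p.1 + b p.2 + c (s - p.1 - p.2) = v ∧
        IsStrictTop ![σ, t] (Finset.univ.image fun p : G × G => a p.1 + b p.2 + c (s - p.1 - p.2)) v ∧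
        rank σ C t (c (s - p.1 - p.2)) < k).card ≤ E.card + ∑ z, f z (s - z) := by
    intro s
    refine (card_kshallowTops_class_le a b c σ k s E).trans (le_of_eq ?_)
    rfl
  refine (Finset.sum_le_sum fun s _ => hclass s).trans ?_
  rw [Finset.sum_add_distrib, Finset.sum_const, Finset.card_univ, smul_eq_mul]
  -- re-index `s ↦ s - z`
  have hre : ∑ s, ∑ z, f z (s - z) = ∑ r, ∑ z, f z r := by
    rw [Finset.sum_comm]
    refine (Finset.sum_congr rfl fun z _ => ?_).trans Finset.sum_comm
    exact Equiv.sum_comp (Equiv.subRight z) (f z)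
  rw [hre]
  -- cells
  set I : Finset ℕ := Finset.range (E.card + 1) with hI
  set J : ℕ → Set ℝ := fun i => {t : ℝ | t ∉ E ∧ cellIdx E t = i} with hJ
  have hJord : ∀ i ∈ I, ∀ j ∈ I, i ≠ j →
      (∀ t ∈ J i, ∀ t' ∈ J j, t < t') ∨ (∀ t ∈ J i, ∀ t' ∈ J j, t' < t) := fun i _ j _ hij => cells_ordered E hij
  -- the top set of a cell
  set T : ℕ → Finset (Fin 2 → ℝ) := fun i =>
    if h : ∃ t : ℝ, t ∉ E ∧ cellIdx E t = i then topSet σ C k (Classical.choose h) else ∅ with hT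
  have hTmem : ∀ (i : ℕ) (t : ℝ), t ∉ E → cellIdx E t = i → topSet σ C k t = T i := by
    intro i t ht hti
    have h : ∃ t : ℝ, t ∉ E ∧ cellIdx E t = i := ⟨t, ht, hti⟩
    rw [hT]
    simp only [h, dif_pos]
    exact topSet_eq_of_cellIdx_eq' hEall ht (Classical.choose_spec h).1 (hti.trans (Classical.choose_spec h).2.symm)
  have hTcard : ∀ i, (T i).card ≤ k := by
    intro i
    rw [hT]
    by_cases h : ∃ t : ℝ, t ∉ E ∧ cellIdx E t = i
    · simp only [h, dif_pos]
      exact card_topSet_le_of_forall_ne (hEne _ (Classical.choose_spec h).1)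
    · simp only [h, dif_neg, not_false_eq_true, Finset.card_empty]
      exact Nat.zero_le _
  -- tops of a fibre along a cell
  set g : ℕ → G → ℕ := fun i r => ((P r).filter fun q => ∃ t ∈ J i, IsStrictTop ![σ, t] (P r) q).card with hg
  -- per (z, r): charge through the cells whose top set contains `c z`
  have hfz : ∀ z r, f z r ≤ ∑ i ∈ I, (if c z ∈ T i then g i r else 0) := by
    intro z r
    rw [hf]
    calc ((P r).filter fun q => ∃ t : ℝ, t ∉ E ∧ rank σ C t (c z) < k ∧ IsStrictTop ![σ, t] (P r) q).card
        ≤ ((I.filter fun i => c z ∈ T i).biUnion fun i => (P r).filter fun q => ∃ t ∈ J i, IsStrictTop ![σ, t] (P r) q).card := by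
          refine Finset.card_le_card fun q hq => ?_
          obtain ⟨hqP, t, htE, hrk, htop⟩ := Finset.mem_filter.1 hq
          have hiI : cellIdx E t ∈ I := Finset.mem_range.2 (Nat.lt_succ_of_le (cellIdx_le_card E t))
          have hcz : c z ∈ T (cellIdx E t) := by
            rw [← hTmem (cellIdx E t) t htE rfl]
            exact Finset.mem_filter.2 ⟨Finset.mem_image.2 ⟨z, Finset.mem_univ _, rfl⟩, hrk⟩
          exact Finset.mem_biUnion.2 ⟨cellIdx E t, Finset.mem_filter.2 ⟨hiI, hcz⟩,
            Finset.mem_filter.2 ⟨hqP, t, ⟨htE, rfl⟩, htop⟩⟩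
      _ ≤ ∑ i ∈ I.filter (fun i => c z ∈ T i), g i r := Finset.card_biUnion_le
      _ = ∑ i ∈ I, (if c z ∈ T i then g i r else 0) := Finset.sum_filter _ _
  -- number of `z` whose letter lies in a cell's top set
  have hzcount : ∀ i, (Finset.univ.filter fun z : G => c z ∈ T i).card ≤ k := by
    intro i
    calc (Finset.univ.filter fun z : G => c z ∈ T i).card
        = ((Finset.univ.filter fun z : G => c z ∈ T i).image c).card := (Finset.card_image_of_injective _ hc).symm
      _ ≤ (T i).card := Finset.card_le_card fun p hp => by
          obtain ⟨z, hz, rfl⟩ := Finset.mem_image.1 hp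
          exact (Finset.mem_filter.1 hz).2
      _ ≤ k := hTcard i
  -- per fibre
  have hfib : ∀ r, ∑ z, f z r ≤ k * (((P r).filter fun p => ∃ t, IsStrictTop ![σ, t] (P r) p).card + (E.card + 1)) := by
    intro r
    calc ∑ z, f z r ≤ ∑ z, ∑ i ∈ I, (if c z ∈ T i then g i r else 0) := Finset.sum_le_sum fun z _ => hfz z r
      _ = ∑ i ∈ I, ∑ z, (if c z ∈ T i then g i r else 0) := Finset.sum_comm
      _ = ∑ i ∈ I, (Finset.univ.filter fun z : G => c z ∈ T i).card * g i r := by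
          refine Finset.sum_congr rfl fun i _ => ?_
          rw [← Finset.sum_filter, Finset.sum_const, smul_eq_mul]
      _ ≤ ∑ i ∈ I, k * g i r := Finset.sum_le_sum fun i _ => Nat.mul_le_mul_right _ (hzcount i)
      _ = k * ∑ i ∈ I, g i r := (Finset.mul_sum _ _ _).symm
      _ ≤ k * (((P r).filter fun p => ∃ t, IsStrictTop ![σ, t] (P r) p).card + I.card) :=
          Nat.mul_le_mul_left _ (sum_card_chartTops_le I J σ (P r) hJord)
      _ = k * (((P r).filter fun p => ∃ t, IsStrictTop ![σ, t] (P r) p).card + (E.card + 1)) := by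
          rw [hI, Finset.card_range]
  -- assemble
  calc Fintype.card G * E.card + ∑ r, ∑ z, f z r
      ≤ Fintype.card G * E.card + ∑ r, k * (((P r).filter fun p => ∃ t, IsStrictTop ![σ, t] (P r) p).card + (E.card + 1)) :=
        Nat.add_le_add_left (Finset.sum_le_sum fun r _ => hfib r) _
    _ = k * ∑ r, ((P r).filter fun p => ∃ t, IsStrictTop ![σ, t] (P r) p).card +
          Fintype.card G * (E.card + k * (E.card + 1)) := by
        rw [Finset.mul_sum]
        simp only [mul_add]
        rw [Finset.sum_add_distrib, Finset.sum_const, Finset.card_univ, smul_eq_mul]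
        ring
    _ ≤ k * ∑ r, ((P r).filter fun p => ∃ t, IsStrictTop ![σ, t] (P r) p).card +
          Fintype.card G * ((k + 1) * (16 * Fintype.card G * k + 1)) := by
        apply Nat.add_le_add_left
        apply Nat.mul_le_mul_left
        nlinarith [hEcard]
    _ = _ := by ring

open Classical in
/-- **`k`-shallow vertices are `O(k²|G|²)`**: for `c` injective and `k ≥ 1`,
`∑_s #{hull vertices of class s that are k-shallow in c} ≤ k·(V_P + 2|G|) + 2|G|(k+1)(16|G|k+1)`. [folklore] -/
theorem sum_card_kshallow_le (a b c : G → (Fin 2 → ℝ)) (hc : Function.Injective c) {k : ℕ} (hk : 1 ≤ k) :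
    ∑ s, ((Finset.univ.image fun p : G × G => a p.1 + b p.2 + c (s - p.1 - p.2)).filter fun v =>
        ∃ σ t : ℝ, (σ = 1 ∨ σ = -1) ∧ ∃ p : G × G, a p.1 + b p.2 + c (s - p.1 - p.2) = v ∧
          IsStrictTop ![σ, t] (Finset.univ.image fun p : G × G => a p.1 + b p.2 + c (s - p.1 - p.2)) v ∧
          rank σ (Finset.univ.image c) t (c (s - p.1 - p.2)) < k).card ≤
      k * (fibreTotal a b + 2 * Fintype.card G) + 2 * (Fintype.card G * (k + 1) * (16 * Fintype.card G * k + 1)) := by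
  classical
  have hsplit : ∀ s, ((Finset.univ.image fun p : G × G => a p.1 + b p.2 + c (s - p.1 - p.2)).filter fun v =>
        ∃ σ t : ℝ, (σ = 1 ∨ σ = -1) ∧ ∃ p : G × G, a p.1 + b p.2 + c (s - p.1 - p.2) = v ∧
          IsStrictTop ![σ, t] (Finset.univ.image fun p : G × G => a p.1 + b p.2 + c (s - p.1 - p.2)) v ∧
          rank σ (Finset.univ.image c) t (c (s - p.1 - p.2)) < k).card ≤
      ((Finset.univ.image fun p : G × G => a p.1 + b p.2 + c (s - p.1 - p.2)).filter fun v =>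
        ∃ t : ℝ, ∃ p : G × G, a p.1 + b p.2 + c (s - p.1 - p.2) = v ∧
          IsStrictTop ![1, t] (Finset.univ.image fun p : G × G => a p.1 + b p.2 + c (s - p.1 - p.2)) v ∧
          rank 1 (Finset.univ.image c) t (c (s - p.1 - p.2)) < k).card +
      ((Finset.univ.image fun p : G × G => a p.1 + b p.2 + c (s - p.1 - p.2)).filter fun v =>
        ∃ t : ℝ, ∃ p : G × G, a p.1 + b p.2 + c (s - p.1 - p.2) = v ∧
          IsStrictTop ![-1, t] (Finset.univ.image fun p : G × G => a p.1 + b p.2 + c (s - p.1 - p.2)) v ∧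
          rank (-1) (Finset.univ.image c) t (c (s - p.1 - p.2)) < k).card := by
    intro s
    refine (Finset.card_le_card fun v hv => ?_).trans (Finset.card_union_le _ _)
    obtain ⟨hvF, σ, t, hσ, p, hp, htop, hrk⟩ := Finset.mem_filter.1 hv
    rw [Finset.mem_union, Finset.mem_filter, Finset.mem_filter]
    rcases hσ with rfl | rfl
    · exact Or.inl ⟨hvF, t, p, hp, htop, hrk⟩
    · exact Or.inr ⟨hvF, t, p, hp, htop, hrk⟩
  have h₁ := sum_card_kshallowTops_le a b c hc (σ := 1) one_ne_zero hk
  have h₂ := sum_card_kshallowTops_le a b c hc (σ := -1) (by norm_num) hk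
  have hfib : ∀ r : G, ((Finset.univ.image fun x : G => a x + b (r - x)).filter fun p =>
        ∃ t, IsStrictTop ![1, t] (Finset.univ.image fun x : G => a x + b (r - x)) p).card +
      ((Finset.univ.image fun x : G => a x + b (r - x)).filter fun p =>
        ∃ t, IsStrictTop ![-1, t] (Finset.univ.image fun x : G => a x + b (r - x)) p).card ≤ fibreVert a b r + 2 :=
    fun r => card_chartTops_fibre_add_le a b r
  set S₁ := ∑ r : G, ((Finset.univ.image fun x : G => a x + b (r - x)).filter fun p =>
        ∃ t, IsStrictTop ![1, t] (Finset.univ.image fun x : G => a x + b (r - x)) p).card with hS₁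
  set S₂ := ∑ r : G, ((Finset.univ.image fun x : G => a x + b (r - x)).filter fun p =>
        ∃ t, IsStrictTop ![-1, t] (Finset.univ.image fun x : G => a x + b (r - x)) p).card with hS₂
  set X := Fintype.card G * (k + 1) * (16 * Fintype.card G * k + 1) with hX
  have hsum : S₁ + S₂ ≤ fibreTotal a b + 2 * Fintype.card G := by
    rw [hS₁, hS₂, ← Finset.sum_add_distrib]
    calc _ ≤ ∑ r : G, (fibreVert a b r + 2) := Finset.sum_le_sum fun r _ => hfib r
      _ = fibreTotal a b + 2 * Fintype.card G := by
          unfold fibreTotal; rw [Finset.sum_add_distrib, Finset.sum_const, Finset.card_univ, smul_eq_mul]; ring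
  calc _ ≤ _ := Finset.sum_le_sum fun s _ => hsplit s
    _ ≤ (k * S₁ + X) + (k * S₂ + X) := by rw [Finset.sum_add_distrib]; exact add_le_add h₁ h₂
    _ = k * (S₁ + S₂) + 2 * X := by ring
    _ ≤ k * (fibreTotal a b + 2 * Fintype.card G) + 2 * X := by gcongr

open Classical in
/-- **All vertices `k`-shallow in `c` ⇒ `T ≤ k(V_P + 2|G|) + 2|G|(k+1)(16|G|k+1)`** (`c` injective, `k ≥ 1`): the `n = 3` totals law
with constant `O(k²)` on the stratum where every hull vertex of every class has, at some exposing chart weight, a spelling whose third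
letter is among the top `k` of `C`. [folklore] -/
theorem totalVert_le_of_all_kshallow (a b c : G → (Fin 2 → ℝ)) (hc : Function.Injective c) {k : ℕ} (hk : 1 ≤ k)
    (hall : ∀ (s : G) (v : Fin 2 → ℝ), v ∈ (convexHull ℝ (classPts a b c s)).extremePoints ℝ →
      ∃ σ t : ℝ, (σ = 1 ∨ σ = -1) ∧ ∃ p : G × G, a p.1 + b p.2 + c (s - p.1 - p.2) = v ∧
        IsStrictTop ![σ, t] (Finset.univ.image fun p : G × G => a p.1 + b p.2 + c (s - p.1 - p.2)) v ∧
        rank σ (Finset.univ.image c) t (c (s - p.1 - p.2)) < k) :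
    totalVert a b c ≤ k * (fibreTotal a b + 2 * Fintype.card G) +
      2 * (Fintype.card G * (k + 1) * (16 * Fintype.card G * k + 1)) := by
  classical
  refine le_trans ?_ (sum_card_kshallow_le a b c hc hk)
  unfold totalVert
  refine Finset.sum_le_sum fun s _ => ?_
  set F := Finset.univ.image fun p : G × G => a p.1 + b p.2 + c (s - p.1 - p.2) with hF
  have hcoe : (F : Set (Fin 2 → ℝ)) = classPts a b c s := by
    rw [hF, Finset.coe_image, Finset.coe_univ, Set.image_univ]; rfl
  unfold classVert
  rw [← Set.ncard_coe_finset]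
  refine Set.ncard_le_ncard (fun v hv => ?_) (Finset.finite_toSet _)
  have hvF : v ∈ F := by
    rw [← Finset.mem_coe, hcoe]; exact extremePoints_convexHull_subset hv
  exact Finset.mem_coe.2 (Finset.mem_filter.2 ⟨hvF, hall s v hv⟩)

end Count

end TotalsLaw

end Summit.ValiantsHypothesis.ValiantsHypothesis.Theorems.NewtonUnitEquationsDissociatedUniform
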